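import Literature.MathematicalPhysics.QuantumFieldTheory.Balaban1983to89.Beta.DressedMomentNormalisation
import Summits.QuantumFields.BalabanUV.Beta.D1BFx.ReducedKernelSandwich

/-!
# `BalabanUV.Beta.FP.DressedEntryWeightAlgebra` — road «FP», binder row D1, ROUTE T, the (H5-F) option (3a) (road `g61/JUNCTION-F.md` §2 (e); an2 g84 RCPT-4 l.69153):
# **THE TWO-SIDED DRESSED KERNEL IS ADDITIVE IN ITS WEIGHTS, AND A GRADIENT WEIGHT IS KILLED BY A TRANSVERSE TABLE** — the [folklore] weight algebra of lit
# `DecimatedMomentSummable.dressedSum` ∕ `DressedMomentNormalisation.dressedEntry` under absolutely summable second moments (`AbsMoment₂`)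

WHY (journal l.69153 an2 RCPT-4 (3a); road A-4 l.69160).  By value (Engine C R-AN2-84-HQF0) the nested tower's top-step response column to a coarse unit source is the
straight `wStep` column PLUS an exact pure gauge mode: `m_a = 3⁻⁵·W_a + dξ_a`.  Option (3a) dresses the END's F-family by the true weight `wF := 3⁻⁵•wStep + dξ`; the transport
clause `htr ∕ hF₁` of the END consumer then reads `dressedEntry (wF j) 𝒯_j` where the literal has `dressedEntry (wStep Lc (j+1)) 𝒯_j`, and the two agree iff the gradient part
drops out — which is the case when the table `𝒯_j` (the composite one-loop kernel) is Ward-TRANSVERSE (the one displayed junction `hWT` of (3a)).  THIS FILE is the algebra of that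
step and nothing else: (i) `dressedSum`∕`dressedEntry` are additive in the left and in the right weight (each fibre series converges absolutely — `summable_dressed_fibre`);
(ii) a FORWARD-DIFFERENCE left weight `u ↦ φ (u + e_c) − φ u` shifts the output point: `dressedSum (Δ_c φ) T w′ y = dressedSum φ T w′ (y − e_c) − dressedSum φ T w′ y`
(re-indexing `u ↦ u + e_c`, `Equiv.addRight`); (iii) hence, summed over the direction `c` against a table family `T c` whose BACKWARD DIVERGENCE vanishes
(`Σ_c (T c z − T c (z − e_c)) = 0`), the gradient-weight term is ZERO; (iv) the mirror statements on the right leg.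

WHAT ([folklore] `tsum` bookkeeping over `ℤ^d × ℤ^d`; no `def`, no `def … : Prop`, nothing cited, 0 sorry): §1 `dressedSum_add_left ∕ _add_right`, `dressedEntry` four-term expansion
`dressedEntry_add_weight`; §2 `dressedSum_fwdDiff_left`, **`sum_dressedSum_grad_left_eq_zero`**, `dressedSum_fwdDiff_right`, **`sum_dressedSum_grad_right_eq_zero`**.
WHAT THIS IS NOT: not the transversality of any kernel of the tower (DISPLAYED where used — `hWT`; by value R-FP-61-WARD, to be filed); not the weight `wF` (its gauge part `dξ` is a
definition the row∕road owe, JUNCTION-F §2 (a)); nothing of Bałaban's asserted, valued or discharged; 0 estimates; 0∕4 row-D1 binders (hW, hR, D1Tel, D1Rep); NOT (C1), NOT (T-ID),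
NOT D1, NOT BetaPertH, NOT continuum, NOT Clay.

HONEST DEPENDENCY (page 1, mandatory): continuum YM on T⁴ ⇐ BetaPertH ∧ nine spine estimates (0/9 proved); BetaPertH ⇐ (D1) ∧ (D4) ∧ CAP+tail;
G-an2-4 gates asym, D1 and NE2/3/4.  HONEST FRAMING (cell contract, verbatim): «discharging `BetaPertH` makes Bałaban's UV stability UNCONDITIONAL —
a real constructive-QFT result; it is NOT the continuum limit and NOT the Clay problem.»  ABSOLUTE RULE (cell charter, verbatim): «No internally-minted
statement may enter as a cited fact. Every hypothesis is either kernel-proved in this package or a verbatim quotation of a PUBLISHED theorem with page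
reference. The manuscript(s) under audit are NOT citable for their own disputed steps — they are the thing under adjudication; programme-internal
(2001/route/tribunal) claims are never citable.»  Road «FP» OWNER, b2b-balaban-beta-d1-p3 gen 61, 2026-08-30.  No existing file touched.
-/

noncomputable section

open scoped BigOperators

namespace Summit.QuantumFields.BalabanUV.Beta.FP.DressedEntryWeightAlgebra

open Finset
open Literature.MathematicalPhysics.QuantumFieldTheory.Balaban1983to89.Beta
open Literature.MathematicalPhysics.QuantumFieldTheory.Balaban1983to89.Beta.DecimatedMomentSummable (dressedSum AbsMoment₂ summable_dressed_fibre)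
open Literature.MathematicalPhysics.QuantumFieldTheory.Balaban1983to89.Beta.DressedMomentNormalisation (EKer dressedEntry)
open Summit.QuantumFields.BalabanUV.Beta.D1BFx.ReducedKernelSandwich (absMoment₂_add')

variable {d : ℕ}

/-! ## §1 Additivity in the weights -/

/-- [folklore] the dressed kernel is additive in its LEFT weight (each fibre series converges absolutely). -/
theorem dressedSum_add_left {w₁ w₂ T w' : (Fin d → ℤ) → ℝ} (h₁ : AbsMoment₂ w₁) (h₂ : AbsMoment₂ w₂) (hT : AbsMoment₂ T) (hw' : AbsMoment₂ w')
    (y : Fin d → ℤ) :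
    dressedSum (fun u => w₁ u + w₂ u) T w' y = dressedSum w₁ T w' y + dressedSum w₂ T w' y := by
  unfold dressedSum
  rw [← (summable_dressed_fibre h₁ hT hw' y).tsum_add (summable_dressed_fibre h₂ hT hw' y)]
  exact tsum_congr fun p => by ring

/-- [folklore] the dressed kernel is additive in its RIGHT weight. -/
theorem dressedSum_add_right {w T w₁ w₂ : (Fin d → ℤ) → ℝ} (hw : AbsMoment₂ w) (hT : AbsMoment₂ T) (h₁ : AbsMoment₂ w₁) (h₂ : AbsMoment₂ w₂)
    (y : Fin d → ℤ) :
    dressedSum w T (fun x => w₁ x + w₂ x) y = dressedSum w T w₁ y + dressedSum w T w₂ y := by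
  unfold dressedSum
  rw [← (summable_dressed_fibre hw hT h₁ y).tsum_add (summable_dressed_fibre hw hT h₂ y)]
  exact tsum_congr fun p => by ring

/-- [folklore] **`dressedEntry_add_weight` — THE FOUR-TERM EXPANSION**: dressing by `w₁ + w₂` on both sides = the two pure dressings + the two cross dressings. -/
theorem dressedEntry_add_weight (w₁ w₂ T : EKer d) (h₁ : ∀ κ l, AbsMoment₂ (w₁ κ l)) (h₂ : ∀ κ l, AbsMoment₂ (w₂ κ l)) (hT : ∀ c e, AbsMoment₂ (T c e))
    (y : Fin d → ℤ) (a b : Fin d) :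
    dressedEntry (fun κ l u => w₁ κ l u + w₂ κ l u) T y a b
      = dressedEntry w₁ T y a b + dressedEntry w₂ T y a b
        + (∑ c, ∑ e, dressedSum (w₁ c a) (T c e) (w₂ e b) y + ∑ c, ∑ e, dressedSum (w₂ c a) (T c e) (w₁ e b) y) := by
  unfold dressedEntry
  have h : ∀ c e, dressedSum (fun u => w₁ c a u + w₂ c a u) (T c e) (fun x => w₁ e b x + w₂ e b x) y
      = dressedSum (w₁ c a) (T c e) (w₁ e b) y + dressedSum (w₂ c a) (T c e) (w₂ e b) y
        + (dressedSum (w₁ c a) (T c e) (w₂ e b) y + dressedSum (w₂ c a) (T c e) (w₁ e b) y) := by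
    intro c e
    rw [dressedSum_add_left (h₁ c a) (h₂ c a) (hT c e) (absMoment₂_add' (h₁ e b) (h₂ e b)) y,
      dressedSum_add_right (h₁ c a) (hT c e) (h₁ e b) (h₂ e b) y, dressedSum_add_right (h₂ c a) (hT c e) (h₁ e b) (h₂ e b) y]
    ring
  simp only [h, Finset.sum_add_distrib]

/-! ## §2 A gradient weight is killed by a transverse table -/

/-- [folklore] **`dressedSum_fwdDiff_left`** — a FORWARD-DIFFERENCE left weight `u ↦ φ (u + e) − φ u` shifts the output point:
`dressedSum (Δ_e φ) T w′ y = dressedSum φ T w′ (y − e) − dressedSum φ T w′ y` (re-indexing `u ↦ u + e`). -/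
theorem dressedSum_fwdDiff_left {φ T w' : (Fin d → ℤ) → ℝ} (e : Fin d → ℤ) (hφ : AbsMoment₂ φ) (hΔ : AbsMoment₂ (fun u => φ (u + e) - φ u)) (hT : AbsMoment₂ T)
    (hw' : AbsMoment₂ w') (y : Fin d → ℤ) :
    dressedSum (fun u => φ (u + e) - φ u) T w' y = dressedSum φ T w' (y - e) - dressedSum φ T w' y := by
  -- the shifted-weight fibre converges (it is the difference fibre plus the unshifted one)
  have hS : Summable (fun p : (Fin d → ℤ) × (Fin d → ℤ) => φ (p.1 + e) * T (y + p.1 - p.2) * w' p.2) := by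
    have h := (summable_dressed_fibre hΔ hT hw' y).add (summable_dressed_fibre hφ hT hw' y)
    refine h.congr (fun p => ?_)
    ring
  -- re-index the shifted fibre by `u ↦ u + e`: it is the fibre at the output point `y − e`
  have hre : ∑' p : (Fin d → ℤ) × (Fin d → ℤ), φ (p.1 + e) * T (y + p.1 - p.2) * w' p.2
      = ∑' p : (Fin d → ℤ) × (Fin d → ℤ), φ p.1 * T ((y - e) + p.1 - p.2) * w' p.2 := by
    rw [← (Equiv.prodCongr (Equiv.addRight e) (Equiv.refl (Fin d → ℤ))).tsum_eq
      (fun p : (Fin d → ℤ) × (Fin d → ℤ) => φ p.1 * T ((y - e) + p.1 - p.2) * w' p.2)]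
    refine tsum_congr fun p => ?_
    simp only [Equiv.prodCongr_apply, Prod.map_fst, Prod.map_snd, Equiv.coe_addRight, Equiv.coe_refl, id_eq]
    congr 2
    congr 1
    abel
  unfold dressedSum
  rw [← hre, ← hS.tsum_sub (summable_dressed_fibre hφ hT hw' y)]
  exact tsum_congr fun p => by ring

/-- [folklore] **`sum_dressedSum_grad_left_eq_zero` — A GRADIENT LEFT WEIGHT IS KILLED BY A TABLE FAMILY WITH VANISHING BACKWARD DIVERGENCE**:
for `g c = Δ_{e_c} φ` (`e_c := Pi.single c 1`) and `Σ_c (T c z − T c (z − e_c)) = 0` for every `z`, `Σ_c dressedSum (g c) (T c) w′ y = 0`. -/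
theorem sum_dressedSum_grad_left_eq_zero {φ w' : (Fin d → ℤ) → ℝ} (hφ : AbsMoment₂ φ) (hw' : AbsMoment₂ w') {T g : Fin d → (Fin d → ℤ) → ℝ}
    (hT : ∀ c, AbsMoment₂ (T c)) (hg : ∀ c, AbsMoment₂ (g c)) (hgφ : ∀ c u, g c u = φ (u + Pi.single c 1) - φ u)
    (hdiv : ∀ z, ∑ c, (T c z - T c (z - Pi.single c 1)) = 0) (y : Fin d → ℤ) :
    ∑ c, dressedSum (g c) (T c) w' y = 0 := by
  have hg' : ∀ c, g c = fun u => φ (u + Pi.single c 1) - φ u := fun c => funext (hgφ c)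
  have hstep : ∀ c, dressedSum (g c) (T c) w' y = dressedSum φ (T c) w' (y - Pi.single c 1) - dressedSum φ (T c) w' y := by
    intro c
    have hΔ : AbsMoment₂ (fun u => φ (u + Pi.single c 1) - φ u) := hg' c ▸ hg c
    rw [hg' c]
    exact dressedSum_fwdDiff_left (Pi.single c 1) hφ hΔ (hT c) hw' y
  simp only [hstep]
  -- both terms are absolutely convergent fibre series; combine them under ONE `tsum` and use the divergence condition pointwise
  unfold dressedSum
  have hS₁ : ∀ c, Summable (fun p : (Fin d → ℤ) × (Fin d → ℤ) => φ p.1 * T c ((y - Pi.single c 1) + p.1 - p.2) * w' p.2) :=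
    fun c => summable_dressed_fibre hφ (hT c) hw' (y - Pi.single c 1)
  have hS₂ : ∀ c, Summable (fun p : (Fin d → ℤ) × (Fin d → ℤ) => φ p.1 * T c (y + p.1 - p.2) * w' p.2) :=
    fun c => summable_dressed_fibre hφ (hT c) hw' y
  have hsub : ∀ c, ∑' p : (Fin d → ℤ) × (Fin d → ℤ), φ p.1 * T c ((y - Pi.single c 1) + p.1 - p.2) * w' p.2
      - ∑' p : (Fin d → ℤ) × (Fin d → ℤ), φ p.1 * T c (y + p.1 - p.2) * w' p.2
      = ∑' p : (Fin d → ℤ) × (Fin d → ℤ), φ p.1 * w' p.2 * (T c ((y - Pi.single c 1) + p.1 - p.2) - T c (y + p.1 - p.2)) := by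
    intro c
    rw [← (hS₁ c).tsum_sub (hS₂ c)]
    exact tsum_congr fun p => by ring
  simp only [hsub]
  rw [← Summable.tsum_finsetSum (fun c _ => ((hS₁ c).sub (hS₂ c)).congr (fun p => by ring))]
  refine (tsum_congr fun p => ?_).trans tsum_zero
  rw [← Finset.mul_sum]
  have hz := hdiv (y + p.1 - p.2)
  have hre : ∀ c, T c ((y - Pi.single c 1) + p.1 - p.2) = T c (y + p.1 - p.2 - Pi.single c 1) := fun c => by
    congr 1; abel
  simp only [hre]
  rw [show (∑ c, (T c (y + p.1 - p.2 - Pi.single c 1) - T c (y + p.1 - p.2))) = -(∑ c, (T c (y + p.1 - p.2) - T c (y + p.1 - p.2 - Pi.single c 1))) by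
    rw [← Finset.sum_neg_distrib]; exact Finset.sum_congr rfl fun c _ => by ring, hz, neg_zero, mul_zero]

/-- [folklore] **`dressedSum_fwdDiff_right`** — a forward-difference RIGHT weight `x ↦ ψ (x + e) − ψ x` shifts the output point the other way:
`dressedSum w T (Δ_e ψ) y = dressedSum w T ψ (y + e) − dressedSum w T ψ y`. -/
theorem dressedSum_fwdDiff_right {w T ψ : (Fin d → ℤ) → ℝ} (e : Fin d → ℤ) (hw : AbsMoment₂ w) (hT : AbsMoment₂ T) (hψ : AbsMoment₂ ψ)
    (hΔ : AbsMoment₂ (fun x => ψ (x + e) - ψ x)) (y : Fin d → ℤ) :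
    dressedSum w T (fun x => ψ (x + e) - ψ x) y = dressedSum w T ψ (y + e) - dressedSum w T ψ y := by
  have hS : Summable (fun p : (Fin d → ℤ) × (Fin d → ℤ) => w p.1 * T (y + p.1 - p.2) * ψ (p.2 + e)) := by
    have h := (summable_dressed_fibre hw hT hΔ y).add (summable_dressed_fibre hw hT hψ y)
    refine h.congr (fun p => ?_)
    ring
  have hre : ∑' p : (Fin d → ℤ) × (Fin d → ℤ), w p.1 * T (y + p.1 - p.2) * ψ (p.2 + e)
      = ∑' p : (Fin d → ℤ) × (Fin d → ℤ), w p.1 * T ((y + e) + p.1 - p.2) * ψ p.2 := by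
    rw [← (Equiv.prodCongr (Equiv.refl (Fin d → ℤ)) (Equiv.addRight e)).tsum_eq
      (fun p : (Fin d → ℤ) × (Fin d → ℤ) => w p.1 * T ((y + e) + p.1 - p.2) * ψ p.2)]
    refine tsum_congr fun p => ?_
    simp only [Equiv.prodCongr_apply, Prod.map_fst, Prod.map_snd, Equiv.coe_addRight, Equiv.coe_refl, id_eq]
    congr 2
    congr 1
    abel
  unfold dressedSum
  rw [← hre, ← hS.tsum_sub (summable_dressed_fibre hw hT hψ y)]
  exact tsum_congr fun p => by ring

/-- [folklore] **`sum_dressedSum_grad_right_eq_zero` — A GRADIENT RIGHT WEIGHT IS KILLED BY A TABLE FAMILY WITH VANISHING FORWARD DIVERGENCE**: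
for `g e = Δ_{e_e} ψ` and `Σ_e (T e (z + e_e) − T e z) = 0` for every `z`, `Σ_e dressedSum w (T e) (g e) y = 0`. -/
theorem sum_dressedSum_grad_right_eq_zero {w ψ : (Fin d → ℤ) → ℝ} (hw : AbsMoment₂ w) (hψ : AbsMoment₂ ψ) {T g : Fin d → (Fin d → ℤ) → ℝ}
    (hT : ∀ e, AbsMoment₂ (T e)) (hg : ∀ e, AbsMoment₂ (g e)) (hgψ : ∀ e x, g e x = ψ (x + Pi.single e 1) - ψ x)
    (hdiv : ∀ z, ∑ e, (T e (z + Pi.single e 1) - T e z) = 0) (y : Fin d → ℤ) :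
    ∑ e, dressedSum w (T e) (g e) y = 0 := by
  have hg' : ∀ e, g e = fun x => ψ (x + Pi.single e 1) - ψ x := fun e => funext (hgψ e)
  have hstep : ∀ e, dressedSum w (T e) (g e) y = dressedSum w (T e) ψ (y + Pi.single e 1) - dressedSum w (T e) ψ y := by
    intro e
    have hΔ : AbsMoment₂ (fun x => ψ (x + Pi.single e 1) - ψ x) := hg' e ▸ hg e
    rw [hg' e]
    exact dressedSum_fwdDiff_right (Pi.single e 1) hw (hT e) hψ hΔ y
  simp only [hstep]
  unfold dressedSum
  have hS₁ : ∀ e, Summable (fun p : (Fin d → ℤ) × (Fin d → ℤ) => w p.1 * T e ((y + Pi.single e 1) + p.1 - p.2) * ψ p.2) :=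
    fun e => summable_dressed_fibre hw (hT e) hψ (y + Pi.single e 1)
  have hS₂ : ∀ e, Summable (fun p : (Fin d → ℤ) × (Fin d → ℤ) => w p.1 * T e (y + p.1 - p.2) * ψ p.2) :=
    fun e => summable_dressed_fibre hw (hT e) hψ y
  have hsub : ∀ e, ∑' p : (Fin d → ℤ) × (Fin d → ℤ), w p.1 * T e ((y + Pi.single e 1) + p.1 - p.2) * ψ p.2
      - ∑' p : (Fin d → ℤ) × (Fin d → ℤ), w p.1 * T e (y + p.1 - p.2) * ψ p.2
      = ∑' p : (Fin d → ℤ) × (Fin d → ℤ), w p.1 * ψ p.2 * (T e ((y + Pi.single e 1) + p.1 - p.2) - T e (y + p.1 - p.2)) := by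
    intro e
    rw [← (hS₁ e).tsum_sub (hS₂ e)]
    exact tsum_congr fun p => by ring
  simp only [hsub]
  rw [← Summable.tsum_finsetSum (fun e _ => ((hS₁ e).sub (hS₂ e)).congr (fun p => by ring))]
  refine (tsum_congr fun p => ?_).trans tsum_zero
  rw [← Finset.mul_sum]
  have hz := hdiv (y + p.1 - p.2)
  have hre : ∀ e, T e ((y + Pi.single e 1) + p.1 - p.2) = T e (y + p.1 - p.2 + Pi.single e 1) := fun e => by
    congr 1; abel
  simp only [hre]
  rw [hz, mul_zero]

end Summit.QuantumFields.BalabanUV.Beta.FP.DressedEntryWeightAlgebra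

end
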